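import Summits.BirchSwinnertonDyer.BirchSwinnertonDyer.Theorems.SignedLowerHalvesSmallImageLowerHalfBothSignsRttEulerLayerK
import Summits.BirchSwinnertonDyer.BirchSwinnertonDyer.Theorems.SignedLowerHalvesSmallImageLowerHalfBothSignsRttLayerLawUndepletedK
import Summits.BirchSwinnertonDyer.BirchSwinnertonDyer.Theorems.SignedLowerHalvesSmallImageLowerHalfBothSignsRttEngineCMCurve
import HarnessLib

/-!
# Route `SignedLowerHalves`, crux L `SmallImageLowerHalfBothSigns` (item stmt-BirchSwinnertonDyer-23599), line `rtt_w3` —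
# bridge between the partner-side local term of AN_g and Greenberg–Vatsal's `δ_W^{(v)}`: a residue-free formula for `δ`, and
# equality of the two local terms at places good for both `W` and `g` under the congruence

Width seat `bsd-line-slh-p3-w3` g12 under LEAD `cruxlead-stmt-BirchSwinnertonDyer-23599` (cell `bsd-ssimc`); ROUTE-INDEPENDENT
helper (`--supports stmt-BirchSwinnertonDyer-23599`); THEOREMS ONLY — no definition, no named fact, no `sorry`; closes nothing;
BSD is not proved by any of this.

WHAT. AN_g (`…RttLayerLawDepletedK`, p748849) reads the depleted layer-`λ` of the partner with the local terms
`p^{v_p(f_ℓ)}·λ(P_{g,ℓ}(ℓ⁻¹(X+1)))`, while the engine ENG / (PSB) carries Greenberg–Vatsal's `δ_W^{(v)} = s_ℓ·d_ℓ` (`delta W p v`) on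
the right. This file relates the two currencies (odd `p`):
* §1 `layerLambda_layerEulerFactor_curve` — the `W`-side layer Euler factor `E_{v,n}(W) ∈ ℚ̄_p[X]` has sup norm `1` and
  `layerLambda = δ_W^{(v)}` for `n > v_p(f_ℓ)` (the LEAD's `order_layerEulerFactor`, p743580, transferred from `𝔽_p⟦X⟧` to `ℚ̄_p`);
  `delta_eq_pow_mul_layerLambda` — **`δ_W^{(v)} = p^{v_p(f_ℓ)}·λ(P_{W,ℓ}(ℓ⁻¹(X+1)))`**, a residue-free formula for GV's `δ`
  (`P_{W,ℓ} = 1 − a_ℓ(W)X + 𝟙_{ℓ∤N_W} ℓ X²` read in `ℚ̄_p`, `SmallImageRttOneSided.map_localPolynomialAt_eq_padicAlgCl`).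
* §2 `layerLambda_localQuadratic_eq_of_norm_sub_lt_one` — the layer-free local `λ` only depends on `a mod 𝔪` (same `X²`-coefficient);
  **`pow_mul_layerLambda_partnerLocal_eq_delta_of_good`** — at a place `v = (ℓ)`, `ℓ ≠ p`, good for `W` and prime to the partner's
  level `M`, the congruence `‖ι a_ℓ(g) − a_ℓ(W)‖ < 1` (ENG's hypothesis off `p·M·N_W`) gives
  `p^{v_p(f_ℓ)}·λ(P_{g,ℓ}(ℓ⁻¹(X+1))) = δ_W^{(v)}`: the two local terms of (PSB) AGREE at every place of `S₀` good for both sides, so the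
  partner Selmer bound only sees the bad places of `W` and of `M`.

References: [GreenbergVatsal2000] §2 Prop. (2.4) (p. 22), §1 (9); [PollackWeston2011MT] §3.1; [BDKim2009] Cor. 2.13 (currency);
[SilvermanAEC2009] §C.16.
-/

set_option autoImplicit false
-- D-0017: single-problem summit, the namespace repeats the problem name by design.
set_option linter.dupNamespace false
noncomputable section

open scoped Classical MatrixGroups ModularForm

open Polynomial NumberField IsDedekindDomain WeierstrassCurve Literature.NumberTheory.EllipticCurves
  Literature.NumberTheory.EllipticCurves.ModularForms Literature.NumberTheory.EllipticCurves.GreenbergVatsal2000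
  Literature.NumberTheory.IwasawaTheory Rat.HeightOneSpectrum
  Summit.BirchSwinnertonDyer.Rank1Residual.X2.EulerFactorInvariants
  Summit.BirchSwinnertonDyer.BirchSwinnertonDyer.Theorems.ThetaLayerLambdaCongruenceAtTwo
  Summit.BirchSwinnertonDyer.BirchSwinnertonDyer.Theorems.ResidualThetaLayer
  Summit.BirchSwinnertonDyer.BirchSwinnertonDyer.Theorems.SmallImageRttOneSided

namespace Summit.BirchSwinnertonDyer.BirchSwinnertonDyer.Theorems.SmallImageRttLayerLawK

variable {p : ℕ} [hp : Fact p.Prime] (W : WeierstrassCurve ℚ) [W.IsElliptic] [W.IsGloballyMinimal]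
  (v : HeightOneSpectrum (𝓞 ℚ))

/-! ## §1 The `W`-side layer Euler factor in `ℚ̄_p[X]` and a residue-free formula for `δ_W^{(v)}` -/

section Curve

omit [W.IsElliptic] [W.IsGloballyMinimal] in
/-- **`λ(E_{v,n}(W)) = δ_W^{(v)}` and `‖E_{v,n}(W)‖_sup = 1` in `ℚ̄_p[X]`** (odd `p`, `ℓ ≠ p`, `n > v_p(f_ℓ)`): the `W`-side layer Euler
factor `E_{v,n}(W) = P_{W,v}(ℓ⁻¹(X+1)^{e_{v,n}})` is the image of an integral polynomial whose reduction has `X`-order `δ_W^{(v)}`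
(the LEAD's `order_layerEulerFactor`), so `layerLambda_map_eq_of_order` applies. [cite: GreenbergVatsal2000, §2 Prop. (2.4) (p. 22)] -/
theorem layerLambda_layerEulerFactor_curve (hp2 : p ≠ 2) (hℓ : natGenerator v ≠ p) {n : ℕ}
    (hn : (frobeniusExponent p (natGenerator v : ℤ_[p])).valuation < n) :
    layerLambda (((W.localPolynomialAt v).map (Int.castRingHom (PadicAlgCl p))).comp
        (C ((natGenerator v : PadicAlgCl p)⁻¹) *
          (X + 1) ^ (PadicInt.toZModPow n (-(frobeniusExponent p (natGenerator v : ℤ_[p])))).val)) = delta W p v ∧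
      (((W.localPolynomialAt v).map (Int.castRingHom (PadicAlgCl p))).comp
        (C ((natGenerator v : PadicAlgCl p)⁻¹) *
          (X + 1) ^ (PadicInt.toZModPow n (-(frobeniusExponent p (natGenerator v : ℤ_[p])))).val)).supNorm = 1 := by
  set φ : ℤ_[p] →+* PadicAlgCl p := (algebraMap ℚ_[p] (PadicAlgCl p)).comp (algebraMap ℤ_[p] ℚ_[p]) with hφdef
  have hφ : ∀ x, ‖φ x‖ = ‖x‖ := norm_algebraMap_comp_padicInt
  set e : ℕ := (PadicInt.toZModPow n (-(frobeniusExponent p (natGenerator v : ℤ_[p])))).val with he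
  set E : ℤ_[p][X] := ((W.localPolynomialAt v).map (Int.castRingHom ℤ_[p])).comp
      (C ((natGenerator v : ℤ_[p]).inv) * (X + 1) ^ e) with hE
  have hφint : φ.comp (Int.castRingHom ℤ_[p]) = Int.castRingHom (PadicAlgCl p) := RingHom.ext_int _ _
  have hφinv : φ ((natGenerator v : ℤ_[p]).inv) = ((natGenerator v : PadicAlgCl p))⁻¹ := by
    obtain ⟨hcop, -⟩ := coprime_natGenerator v (p := p) hℓ
    have hnorm : ‖(natGenerator v : ℤ_[p])‖ = 1 := PadicInt.norm_natCast_eq_one_iff.mpr hcop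
    have hmul : φ (natGenerator v : ℤ_[p]) * φ ((natGenerator v : ℤ_[p]).inv) = 1 := by
      rw [← map_mul, PadicInt.mul_inv hnorm, map_one]
    rw [map_natCast] at hmul
    exact eq_inv_of_mul_eq_one_right hmul
  have hEmap : E.map φ = ((W.localPolynomialAt v).map (Int.castRingHom (PadicAlgCl p))).comp
      (C ((natGenerator v : PadicAlgCl p)⁻¹) * (X + 1) ^ e) := by
    rw [hE, Polynomial.map_comp, Polynomial.map_map, hφint, Polynomial.map_mul, Polynomial.map_C, hφinv,
      Polynomial.map_pow, Polynomial.map_add, Polynomial.map_X, Polynomial.map_one]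
  have hord := order_layerEulerFactor W v hp2 hℓ hn
  rw [← hEmap]
  exact layerLambda_map_eq_of_order φ hφ hord

/-- **A residue-free formula for Greenberg–Vatsal's `δ`** (odd `p`, `ℓ ≠ p`):
`δ_W^{(v)} = p^{v_p(f_ℓ)} · λ(P_{W,ℓ}(ℓ⁻¹(X+1)))` with `P_{W,ℓ} = 1 − a_ℓ(W)·X + 𝟙_{ℓ∤N_W}·ℓ·X²` read in `ℚ̄_p[X]` (`a_ℓ(W) = W.LFunction ℓ`)
and `λ = layerLambda` (least index attaining the Gauss norm) — the `W`-side twin of the local term of AN_g, at the layer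
`n = v_p(f_ℓ) + 1` via `layerEulerFactorK` and `layerLambda_layerEulerFactor_curve`. [cite: GreenbergVatsal2000, §2 Prop. (2.4) (p. 22)] -/
theorem delta_eq_pow_mul_layerLambda (hp2 : p ≠ 2) (hℓ : natGenerator v ≠ p) :
    delta W p v = p ^ (frobeniusExponent p (natGenerator v : ℤ_[p])).valuation *
      layerLambda ((1 - C ((W.LFunction (natGenerator v) : PadicAlgCl p)) * X +
        (if natGenerator v ∣ W.conductorNorm ℤ then 0 else C (natGenerator v : PadicAlgCl p)) * X ^ 2).comp
          (C ((natGenerator v : PadicAlgCl p)⁻¹) * (X + 1))) := by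
  have hn : (frobeniusExponent p (natGenerator v : ℤ_[p])).valuation <
      (frobeniusExponent p (natGenerator v : ℤ_[p])).valuation + 1 := Nat.lt_succ_self _
  have ha : ‖((W.LFunction (natGenerator v) : ℤ) : PadicAlgCl p)‖ ≤ 1 := by
    rw [norm_intCast_padicAlgCl]; exact PadicInt.norm_le_one _
  obtain ⟨-, -, hlam⟩ := layerEulerFactorK (p := p) (W.conductorNorm ℤ) v ((W.LFunction (natGenerator v) : PadicAlgCl p)) hℓ
    ha hn
  obtain ⟨hδ, -⟩ := layerLambda_layerEulerFactor_curve (p := p) W v hp2 hℓ hn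
  rw [map_localPolynomialAt_eq_padicAlgCl] at hδ
  rw [← hδ, hlam]

end Curve

/-! ## §2 The local term only depends on `a_ℓ mod 𝔪`; agreement with `δ_W^{(v)}` at good places under the congruence -/

section Bridge

/-- **The layer-free local `λ` only sees `a mod 𝔪`**: for a unit `l`, `‖a‖, ‖a′‖ ≤ 1` with `‖a − a′‖ < 1` and a common
coefficient `c` of norm `≤ 1`, the polynomials `(1 − aX + cX²)(l⁻¹(X+1))` and `(1 − a′X + cX²)(l⁻¹(X+1))` have the same `layerLambda`
(both have sup norm `1`, their difference `(a′ − a) l⁻¹ (X+1)` has sup norm `< 1`; ultrametric stability of `λ`).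
[cite: PollackWeston2011MT, §3.1] [cite: GreenbergVatsal2000, §2 Prop. (2.4) (p. 22)] -/
theorem layerLambda_localQuadratic_eq_of_norm_sub_lt_one {l a a' c : PadicAlgCl p} (hl1 : ‖l‖ = 1) (ha : ‖a‖ ≤ 1)
    (hc : ‖c‖ ≤ 1) (haa' : ‖a - a'‖ < 1) :
    layerLambda ((1 - C a * X + C c * X ^ 2).comp (C l⁻¹ * (X + 1))) =
      layerLambda ((1 - C a' * X + C c * X ^ 2).comp (C l⁻¹ * (X + 1))) := by
  -- both polynomials in the `α + βX + γX²` form, with sup norm `1`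
  have hu : ‖l⁻¹‖ = 1 := by rw [norm_inv, hl1, inv_one]
  have hcomp : ∀ b : PadicAlgCl p, (1 - C b * X + C c * X ^ 2).comp (C l⁻¹ * (X + 1)) =
      C (1 - b * l⁻¹ + c * l⁻¹ ^ 2) + C (-(b * l⁻¹) + 2 * c * l⁻¹ ^ 2) * X + C (c * l⁻¹ ^ 2) * X ^ 2 := by
    intro b
    rw [add_comp, sub_comp, one_comp, mul_comp, C_comp, X_comp, mul_comp, C_comp, pow_comp, X_comp]
    simp only [map_add, map_sub, map_mul, map_neg, map_pow, map_one, map_ofNat]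
    ring
  have hsup : ((1 - C a * X + C c * X ^ 2).comp (C l⁻¹ * (X + 1))).supNorm = 1 := by
    obtain ⟨-, h1, -⟩ := layerEulerFactorK_aux (p := p) (t := 0) (e' := 1) hl1 ha hc
      (fun h ↦ hp.out.one_lt.ne' (Nat.dvd_one.mp h))
    rw [pow_zero, one_mul, pow_one, add_sub_cancel_right] at h1
    rw [hcomp a]
    exact h1
  -- the difference is `C((a' − a) l⁻¹)·(X+1)`, of sup norm `‖a − a'‖ < 1`
  have hdiff : (1 - C a * X + C c * X ^ 2).comp (C l⁻¹ * (X + 1)) -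
      C (1 : PadicAlgCl p) * (1 - C a' * X + C c * X ^ 2).comp (C l⁻¹ * (X + 1)) =
        C ((a' - a) * l⁻¹) * (X + 1) := by
    rw [hcomp a, hcomp a', map_one, one_mul]
    simp only [map_add, map_sub, map_mul, map_neg, map_pow, map_one, map_ofNat]
    ring
  refine layerLambda_eq_of_supNorm_sub_C_mul_lt (c := (1 : PadicAlgCl p)) one_ne_zero ?_
  rw [hdiff, ResidualThetaLayer.supNorm_C_mul, hsup, norm_mul, hu, mul_one, ← pow_one (X + 1 : (PadicAlgCl p)[X]),
    supNorm_X_add_one_pow, mul_one, norm_sub_rev]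
  exact haa'

/-- **At places good for both sides the two local terms of (PSB) agree.** For an odd prime `p`, a place `v = (ℓ)` with `ℓ ≠ p` at
which `W` has good reduction and which is prime to the partner's level `M`, and a coefficient `a ∈ ℚ̄_p` (`= ι a_ℓ(g)`) with `‖a‖ ≤ 1`
and `‖a − a_ℓ(W)‖ < 1` (ENG's congruence hypothesis off `p·M·N_W`): `p^{v_p(f_ℓ)}·λ(P_{g,ℓ}(ℓ⁻¹(X+1))) = δ_W^{(v)}`
(`P_{g,ℓ} = 1 − aX + ℓX²`, `P_{W,ℓ} = 1 − a_ℓ(W)X + ℓX²`, `delta_eq_pow_mul_layerLambda`, §2). [cite: GreenbergVatsal2000, §2 Prop. (2.4) (p. 22)]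
[cite: BDKim2009, Cor. 2.13] -/
theorem pow_mul_layerLambda_partnerLocal_eq_delta_of_good (hp2 : p ≠ 2) (hℓ : natGenerator v ≠ p) (M : ℕ)
    (hM : ¬ natGenerator v ∣ M) (hgood : W.HasGoodReductionAt v) {a : PadicAlgCl p} (ha : ‖a‖ ≤ 1)
    (hcong : ‖a - (W.frobeniusTrace (natGenerator v) : PadicAlgCl p)‖ < 1) :
    p ^ (frobeniusExponent p (natGenerator v : ℤ_[p])).valuation *
        layerLambda ((1 - C a * X + (if natGenerator v ∣ M then 0 else C (natGenerator v : PadicAlgCl p)) * X ^ 2).comp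
          (C ((natGenerator v : PadicAlgCl p)⁻¹) * (X + 1))) = delta W p v := by
  have hndvd : ¬ natGenerator v ∣ W.conductorNorm ℤ := fun h ↦ (WeierstrassCurve.dvd_conductorNorm_iff W v).mp h hgood
  haveI : Fact (natGenerator v).Prime := ⟨Rat.HeightOneSpectrum.prime_natGenerator v⟩
  have haW : W.LFunction (natGenerator v) = W.frobeniusTrace (natGenerator v) :=
    WeierstrassCurve.LFunction_apply_prime_eq_frobeniusTrace W _
      ((WeierstrassCurve.hasGoodReductionAtPrime_iff_hasGoodReductionAt_ringOfIntegers v W).mpr hgood)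
  obtain ⟨hcop, -⟩ := coprime_natGenerator v (p := p) hℓ
  have hl1 : ‖(natGenerator v : PadicAlgCl p)‖ = 1 := by
    rw [← map_natCast ((algebraMap ℚ_[p] (PadicAlgCl p)).comp (algebraMap ℤ_[p] ℚ_[p])) (natGenerator v),
      norm_algebraMap_comp_padicInt]
    exact PadicInt.norm_natCast_eq_one_iff.mpr hcop
  rw [delta_eq_pow_mul_layerLambda W v hp2 hℓ, if_neg hM, if_neg hndvd, haW]
  congr 1
  have h := layerLambda_localQuadratic_eq_of_norm_sub_lt_one (p := p) (l := (natGenerator v : PadicAlgCl p)) (a := a)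
    (a' := ((W.frobeniusTrace (natGenerator v) : ℤ) : PadicAlgCl p)) (c := (natGenerator v : PadicAlgCl p)) hl1 ha hl1.le
    hcong
  exact h

end Bridge

end Summit.BirchSwinnertonDyer.BirchSwinnertonDyer.Theorems.SmallImageRttLayerLawK

end
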